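import Mathlib
import Literature.Computability.Complexity.CoinCounting
import HarnessLib

/-!
# Coins to field elements: decoding a uniform bit string into a uniform tape over `ZMod p`

Literature / complexity toolkit, a brick of the probabilistically checkable proofs for
exponential-time computations (the verifier of `AlgebraicPCP.lean` draws a tape of field elements;
a `PCPVerifier` of `PCP.lean` draws a uniform BIT string). The standard sampling of a residue
`mod p` from `b` random bits (Arora–Barak 2009, §7.4 / Lemma A.31 "we can simulate a coin of bias
`p/q` …"; Motwani–Raghavan 1995, §1.5): read the bits as a number `v < 2ᵇ`; if
`v < p · ⌊2ᵇ/p⌋` output `v mod p` — EXACTLY uniform on `ZMod p` conditioned on this event — else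
declare the block BAD. A verifier that ACCEPTS on a bad block keeps perfect completeness and
loses `≤ k p / 2ᵇ` in soundness (`k` blocks). This file proves the two counting facts:

* `PCPCoins.Good p b k ρ`, `PCPCoins.dec p b k ρ : Fin k → ZMod p` — the first `k` blocks of
  length `b` of `ρ` are all good / their residues (recursive definitions; `dec_apply`,
  `good_iff` give the blockwise form `⟦ρ[jb, jb+b)⟧`);
* **`cnt_good_dec`** — for every set `S` of tapes,
  `cnt (k b) {ρ | Good ρ ∧ dec ρ ∈ S} = ⌊2ᵇ/p⌋ᵏ · #S` (exact uniformity on the good part);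
* **`cnt_good`**, **`cnt_not_good_le`** — `cnt (k b) {Good} = (p ⌊2ᵇ/p⌋)ᵏ`, hence
  `cnt (k b) {¬ Good} ≤ k p 2^{kb - b}`;
* **`uniformProb_bad_or_dec_le`** — for every event `A` of tapes,
  `Pr_ρ[¬ Good ρ ∨ dec ρ ∈ A] ≤ k p / 2ᵇ + #A / pᵏ`.

Pure counting over `cnt`/`uniformProb` of `CoinCounting.lean`/`Randomized.lean`; nothing here is
in Mathlib or the tree (searched `mod p` sampling, `uniformProb` + `ZMod`: the tree's
`PCPOfGapE3SAT.card_filter_range_mul_mod` is the one-block residue count, re-proved below in sum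
form `sum_range_mul_mod` to stay import-light).

## References

* S. Arora, B. Barak, *Computational Complexity: A Modern Approach*, CUP 2009, §7.4.1 and
  Lemma A.31 (sampling with coins) [AroraBarakCC2009].
* R. Motwani, P. Raghavan, *Randomized Algorithms*, CUP 1995, §1.5 (random residues from bits).
-/

noncomputable section

open Finset

namespace Literature.Computability.Complexity

namespace PCPCoins

/-! ### Bit strings of a fixed length as numbers -/

/-- `bitsToNat` is injective on strings of equal length. (Twin of `Kannan.eq_of_bitsToNat_eq`,
`KannanLanguage.lean`, whose machine-level imports this counting file avoids.) [folklore] -/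
theorem bitsToNat_injective_of_length : ∀ {v w : List Bool}, v.length = w.length → bitsToNat v = bitsToNat w → v = w
  | [], [], _, _ => rfl
  | [], _ :: _, h, _ => by simp at h
  | _ :: _, [], h, _ => by simp at h
  | a :: v, c :: w, hl, h => by
    simp only [bitsToNat_cons] at h
    have hac : a = c := by
      rcases a with _ | _ <;> rcases c with _ | _ <;> simp at h ⊢ <;> omega
    subst hac
    have hvw : bitsToNat v = bitsToNat w := by omega
    rw [bitsToNat_injective_of_length (by simpa using hl) hvw]

/-- **Summing over strings of length `b` is summing over numbers `< 2ᵇ`.** [folklore] -/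
theorem sum_vector_bitsToNat {M : Type*} [AddCommMonoid M] (b : ℕ) (f : ℕ → M) :
    ∑ u : List.Vector Bool b, f (bitsToNat u.toList) = ∑ i ∈ range (2 ^ b), f i := by
  classical
  have hinj : Set.InjOn (fun u : List.Vector Bool b => bitsToNat u.toList) (univ : Finset (List.Vector Bool b)) := by
    intro u _ w _ h
    exact List.Vector.toList_injective (bitsToNat_injective_of_length (by simp) h)
  have himg : (univ : Finset (List.Vector Bool b)).image (fun u => bitsToNat u.toList) = range (2 ^ b) := by
    apply eq_of_subset_of_card_le
    · intro i hi
      obtain ⟨u, -, rfl⟩ := mem_image.1 hi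
      exact mem_range.2 (by simpa using bitsToNat_lt u.toList)
    · rw [card_range, card_image_of_injOn hinj, card_univ, card_vector, Fintype.card_bool]
  rw [← himg, sum_image hinj]

/-- Every number `< 2ᵇ` is the value of a string of length `b`. [folklore] -/
theorem exists_vector_bitsToNat_eq {b i : ℕ} (hi : i < 2 ^ b) : ∃ u : List.Vector Bool b, bitsToNat u.toList = i := by
  classical
  have hinj : Set.InjOn (fun u : List.Vector Bool b => bitsToNat u.toList) (univ : Finset (List.Vector Bool b)) := by
    intro u _ w _ h
    exact List.Vector.toList_injective (bitsToNat_injective_of_length (by simp) h)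
  have himg : (univ : Finset (List.Vector Bool b)).image (fun u => bitsToNat u.toList) = range (2 ^ b) := by
    apply eq_of_subset_of_card_le
    · intro i hi
      obtain ⟨u, -, rfl⟩ := mem_image.1 hi
      exact mem_range.2 (by simpa using bitsToNat_lt u.toList)
    · rw [card_range, card_image_of_injOn hinj, card_univ, card_vector, Fintype.card_bool]
  have : i ∈ (univ : Finset (List.Vector Bool b)).image (fun u => bitsToNat u.toList) := by rw [himg]; exact mem_range.2 hi
  obtain ⟨u, -, hu⟩ := mem_image.1 this
  exact ⟨u, hu⟩

/-- Monotonicity of `cnt` in the event. (Twin of `ZPPExpected.cnt_mono` / `GapMINKTDecision.cnt_mono`,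
whose files carry machine-level imports this counting file avoids.) [folklore] -/
theorem cnt_mono {m : ℕ} {E E' : Set (List Bool)} (h : ∀ y : List Bool, y.length = m → y ∈ E → y ∈ E') : cnt m E ≤ cnt m E' := by
  classical
  unfold cnt
  refine card_le_card fun r hr => ?_
  simp only [mem_filter, mem_univ, true_and] at hr ⊢
  exact h _ r.toList_length hr

/-- Subadditivity of `cnt`. [folklore] -/
theorem cnt_or_le (m : ℕ) (P Q : List Bool → Prop) : cnt m {y | P y ∨ Q y} ≤ cnt m {y | P y} + cnt m {y | Q y} := by
  classical
  unfold cnt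
  refine (card_le_card fun r hr => ?_).trans (card_union_le _ _)
  simp only [mem_filter, mem_univ, true_and, Set.mem_setOf_eq, mem_union] at hr ⊢
  exact hr

/-- **Residues of an initial segment of a multiple of `p`, in sum form**:
`∑_{v < p q} f (v mod p) = q · ∑_{r < p} f r`. [folklore] -/
theorem sum_range_mul_mod {M : Type*} [AddCommMonoid M] (p : ℕ) (f : ℕ → M) :
    ∀ q : ℕ, ∑ v ∈ range (p * q), f (v % p) = q • ∑ r ∈ range p, f r
  | 0 => by simp
  | q + 1 => by
    rw [show p * (q + 1) = p * q + p by ring, sum_range_add, sum_range_mul_mod p f q, add_smul, one_smul]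
    congr 1
    exact sum_congr rfl fun j hj => by rw [Nat.mul_add_mod, Nat.mod_eq_of_lt (mem_range.1 hj)]

/-! ### Counting by the first block -/

/-- The prefix of length `m` of a string of length `m + d`. [folklore] -/
def vtake (m d : ℕ) (r : List.Vector Bool (m + d)) : List.Vector Bool m := ⟨r.toList.take m, by simp⟩

/-- The suffix of length `d` of a string of length `m + d`. [folklore] -/
def vdrop (m d : ℕ) (r : List.Vector Bool (m + d)) : List.Vector Bool d := ⟨r.toList.drop m, by simp⟩

/-- Concatenation of strings of lengths `m` and `d`. [folklore] -/
def vapp {m d : ℕ} (u : List.Vector Bool m) (z : List.Vector Bool d) : List.Vector Bool (m + d) :=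
  ⟨u.toList ++ z.toList, by simp⟩

/-- The prefix as a list. [folklore] -/
@[simp] theorem toList_vtake (m d : ℕ) (r : List.Vector Bool (m + d)) : (vtake m d r).toList = r.toList.take m := rfl

/-- The suffix as a list. [folklore] -/
@[simp] theorem toList_vdrop (m d : ℕ) (r : List.Vector Bool (m + d)) : (vdrop m d r).toList = r.toList.drop m := rfl

/-- The concatenation as a list. [folklore] -/
@[simp] theorem toList_vapp {m d : ℕ} (u : List.Vector Bool m) (z : List.Vector Bool d) : (vapp u z).toList = u.toList ++ z.toList := rfl

/-- **Conditioning on a prefix**: `cnt (m + d) E = ∑_{u ∈ {0,1}ᵐ} cnt d {z | u ++ z ∈ E}`. [folklore] -/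
theorem cnt_add_eq_sum_prefix (m d : ℕ) (E : Set (List Bool)) :
    cnt (m + d) E = ∑ u : List.Vector Bool m, cnt d {z | u.toList ++ z ∈ E} := by
  classical
  unfold cnt
  rw [card_eq_sum_card_fiberwise (f := vtake m d) (t := (univ : Finset (List.Vector Bool m))) fun _ _ => mem_univ _]
  refine sum_congr rfl fun u _ => ?_
  refine card_bij (fun r _ => vdrop m d r) (fun r hr => ?_) (fun r hr r' hr' h => ?_) fun z hz => ?_
  · simp only [mem_filter, mem_univ, true_and] at hr ⊢
    obtain ⟨hE, hu⟩ := hr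
    have hu' : u.toList = r.toList.take m := by rw [← hu]; rfl
    show u.toList ++ r.toList.drop m ∈ E
    rw [hu', List.take_append_drop]
    exact hE
  · simp only [mem_filter, mem_univ, true_and] at hr hr'
    have h1 : r.toList.take m = r'.toList.take m := by
      have := congrArg List.Vector.toList (hr.2.trans hr'.2.symm)
      exact this
    have h2 : r.toList.drop m = r'.toList.drop m := congrArg List.Vector.toList h
    apply List.Vector.toList_injective
    rw [← List.take_append_drop m r.toList, ← List.take_append_drop m r'.toList, h1, h2]
  · simp only [mem_filter, mem_univ, true_and] at hz
    refine ⟨vapp u z, ?_, ?_⟩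
    · simp only [mem_filter, mem_univ, true_and]
      refine ⟨hz, ?_⟩
      apply List.Vector.toList_injective
      show (u.toList ++ z.toList).take m = u.toList
      exact List.take_left' (by simp)
    · apply List.Vector.toList_injective
      show (u.toList ++ z.toList).drop m = z.toList
      exact List.drop_left' (by simp)

/-! ### Good blocks and decoding -/

variable (p b : ℕ)

/-- **The first `k` blocks of length `b` are good**: each has value `< p ⌊2ᵇ/p⌋`. [cite: AroraBarakCC2009, Lemma A.31] -/
def Good : ℕ → List Bool → Prop
  | 0, _ => True
  | k + 1, ρ => bitsToNat (ρ.take b) < p * (2 ^ b / p) ∧ Good k (ρ.drop b)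

/-- **Decoding**: the residues `mod p` of the first `k` blocks. [cite: AroraBarakCC2009, Lemma A.31] -/
def dec : (k : ℕ) → List Bool → (Fin k → ZMod p)
  | 0, _ => Fin.elim0
  | k + 1, ρ => Fin.cons ((bitsToNat (ρ.take b) : ℕ) : ZMod p) (dec k (ρ.drop b))

variable {p b}

/-- Blockwise form of `Good`. [folklore] -/
theorem good_iff : ∀ (k : ℕ) (ρ : List Bool), Good p b k ρ ↔ ∀ j < k, bitsToNat ((ρ.drop (j * b)).take b) < p * (2 ^ b / p)
  | 0, ρ => by simp [Good]
  | k + 1, ρ => by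
    rw [Good, good_iff k (ρ.drop b)]
    constructor
    · rintro ⟨h0, h⟩ j hj
      rcases j with _ | j
      · simpa using h0
      · have := h j (by omega)
        rwa [List.drop_drop, show b + j * b = (j + 1) * b by ring] at this
    · intro h
      refine ⟨by simpa using h 0 (by omega), fun j hj => ?_⟩
      have := h (j + 1) (by omega)
      rwa [show (j + 1) * b = b + j * b by ring, ← List.drop_drop] at this

/-- Blockwise form of `dec`. [folklore] -/
theorem dec_apply : ∀ (k : ℕ) (ρ : List Bool) (j : Fin k),
    dec p b k ρ j = ((bitsToNat ((ρ.drop ((j : ℕ) * b)).take b) : ℕ) : ZMod p)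
  | 0, _, j => j.elim0
  | k + 1, ρ, j => by
    refine Fin.cases ?_ (fun j => ?_) j
    · simp [dec]
    · rw [dec, Fin.cons_succ, dec_apply k (ρ.drop b) j, List.drop_drop, Fin.val_succ,
        show b + (j : ℕ) * b = ((j : ℕ) + 1) * b by ring]

/-- `Good` depends only on the first `k b` bits… in particular on a prefix of length `b`. [folklore] -/
theorem good_succ_append {k : ℕ} {u : List Bool} (hu : u.length = b) (z : List Bool) :
    Good p b (k + 1) (u ++ z) ↔ bitsToNat u < p * (2 ^ b / p) ∧ Good p b k z := by
  rw [Good, List.take_left' hu, List.drop_left' hu]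

/-- `dec` after a block. [folklore] -/
theorem dec_succ_append {k : ℕ} {u : List Bool} (hu : u.length = b) (z : List Bool) :
    dec p b (k + 1) (u ++ z) = Fin.cons ((bitsToNat u : ℕ) : ZMod p) (dec p b k z) := by
  rw [dec, List.take_left' hu, List.drop_left' hu]

/-! ### The fibers of a set of tapes along the first coordinate -/

/-- The tapes `s` with `a :: s ∈ S`. [folklore] -/
def fiber [NeZero p] {k : ℕ} (S : Finset (Fin (k + 1) → ZMod p)) (a : ZMod p) : Finset (Fin k → ZMod p) :=
  open scoped Classical in univ.filter fun s => Fin.cons a s ∈ S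

/-- **The fibers partition `S`**: `∑_{r < p} #fiber S r = #S`. [folklore] -/
theorem sum_card_fiber [NeZero p] {k : ℕ} (S : Finset (Fin (k + 1) → ZMod p)) :
    ∑ r ∈ range p, (fiber S (r : ZMod p)).card = S.card := by
  classical
  -- over `ZMod p`
  have h1 : ∑ a : ZMod p, (fiber S a).card = S.card := by
    rw [card_eq_sum_card_fiberwise (f := fun s : Fin (k + 1) → ZMod p => s 0) (t := univ) fun _ _ => mem_univ _]
    refine sum_congr rfl fun a _ => ?_
    refine card_bij (fun t _ => Fin.cons a t) (fun t ht => ?_) (fun t _ t' _ h => ?_) fun s hs => ?_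
    · unfold fiber at ht
      simp only [mem_filter, mem_univ, true_and] at ht
      exact mem_filter.2 ⟨ht, by simp⟩
    · exact (Fin.cons_injective2.eq_iff.mp h).2
    · simp only [mem_filter] at hs
      refine ⟨Fin.tail s, ?_, ?_⟩
      · unfold fiber
        simp only [mem_filter, mem_univ, true_and]
        rw [← hs.2, Fin.cons_self_tail]
        exact hs.1
      · rw [← hs.2, Fin.cons_self_tail]
  -- reindex `ZMod p` by `range p`
  rw [← h1]
  refine sum_bij (fun (r : ℕ) _ => (r : ZMod p)) (fun _ _ => mem_univ _) (fun r hr r' hr' h => ?_) (fun a _ => ?_) fun _ _ => rfl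
  · have := congrArg ZMod.val h
    rwa [ZMod.val_natCast, ZMod.val_natCast, Nat.mod_eq_of_lt (mem_range.1 hr), Nat.mod_eq_of_lt (mem_range.1 hr')] at this
  · exact ⟨a.val, mem_range.2 (ZMod.val_lt a), ZMod.natCast_zmod_val a⟩

/-! ### Exact uniformity on the good part -/

/-- **The good strings with decoding in `S` number `⌊2ᵇ/p⌋ᵏ · #S`.** [cite: AroraBarakCC2009, Lemma A.31] -/
theorem cnt_good_dec [NeZero p] : ∀ (k : ℕ) (S : Finset (Fin k → ZMod p)),
    cnt (k * b) {ρ | Good p b k ρ ∧ dec p b k ρ ∈ S} = (2 ^ b / p) ^ k * S.card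
  | 0, S => by
    classical
    rw [Nat.zero_mul, pow_zero, one_mul, cnt_zero]
    have hsub : ∀ x : Fin 0 → ZMod p, x = Fin.elim0 := fun x => Subsingleton.elim _ _
    by_cases h : (Fin.elim0 : Fin 0 → ZMod p) ∈ S
    · have hS : S = {Fin.elim0} := eq_singleton_iff_unique_mem.2 ⟨h, fun x _ => hsub x⟩
      rw [hS, card_singleton, if_pos]
      simp only [Set.mem_setOf_eq, Good, dec, true_and]
      exact mem_singleton_self _
    · have hS : S = ∅ := eq_empty_of_forall_notMem fun x hx => h (by rwa [hsub x] at hx)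
      rw [hS, card_empty, if_neg]
      rintro ⟨-, hmem⟩
      exact notMem_empty _ hmem
  | k + 1, S => by
    classical
    set q := 2 ^ b / p with hq
    have hpq : p * q ≤ 2 ^ b := Nat.mul_div_le _ _
    -- conditioning on the first block
    rw [show (k + 1) * b = b + k * b by ring, cnt_add_eq_sum_prefix]
    have hsummand : ∀ u : List.Vector Bool b,
        cnt (k * b) {z | u.toList ++ z ∈ {ρ | Good p b (k + 1) ρ ∧ dec p b (k + 1) ρ ∈ S}} =
          if bitsToNat u.toList < p * q then q ^ k * (fiber S (bitsToNat u.toList : ZMod p)).card else 0 := by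
      intro u
      have hu : u.toList.length = b := by simp
      split_ifs with hlt
      · rw [← cnt_good_dec k (fiber S (bitsToNat u.toList : ZMod p))]
        refine cnt_congr fun z _ => ?_
        simp only [Set.mem_setOf_eq, good_succ_append hu, dec_succ_append hu, fiber, mem_filter, mem_univ, true_and]
        exact ⟨fun h => ⟨h.1.2, h.2⟩, fun h => ⟨⟨hlt, h.1⟩, h.2⟩⟩
      · refine Nat.eq_zero_of_not_pos fun hpos => ?_
        obtain ⟨z, -, hz⟩ := (cnt_pos_iff _ _).1 hpos
        simp only [Set.mem_setOf_eq, good_succ_append hu] at hz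
        exact hlt hz.1.1
    rw [sum_congr rfl fun u _ => hsummand u,
      sum_vector_bitsToNat b fun i => if i < p * q then q ^ k * (fiber S (i : ZMod p)).card else 0]
    -- only `i < p q` contribute
    have hrange : ∑ i ∈ range (2 ^ b), (if i < p * q then q ^ k * (fiber S (i : ZMod p)).card else 0) =
        ∑ i ∈ range (p * q), q ^ k * (fiber S (i : ZMod p)).card := by
      rw [← Finset.sum_subset (fun i hi => mem_range.2 (lt_of_lt_of_le (mem_range.1 hi) hpq))
          (f := fun i => if i < p * q then q ^ k * (fiber S (i : ZMod p)).card else 0)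
          fun i _ hi' => if_neg (not_lt.2 (by simpa using hi'))]
      exact sum_congr rfl fun i hi => if_pos (mem_range.1 hi)
    rw [hrange, ← mul_sum]
    -- residues
    have hmod : ∑ i ∈ range (p * q), (fiber S (i : ZMod p)).card = ∑ i ∈ range (p * q), (fiber S ((i % p : ℕ) : ZMod p)).card :=
      sum_congr rfl fun i _ => by rw [ZMod.natCast_mod]
    rw [hmod, sum_range_mul_mod p (fun r => (fiber S (r : ZMod p)).card) q, smul_eq_mul, sum_card_fiber, pow_succ]
    ring

/-! ### The good event is large -/

/-- **The good strings number `(p ⌊2ᵇ/p⌋)ᵏ`.** [folklore] -/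
theorem cnt_good [NeZero p] (k : ℕ) : cnt (k * b) {ρ | Good p b k ρ} = (p * (2 ^ b / p)) ^ k := by
  classical
  have h := cnt_good_dec (p := p) (b := b) k univ
  rw [card_univ, Fintype.card_fun, Fintype.card_fin, ZMod.card] at h
  rw [mul_pow, mul_comm (p ^ k), ← h]
  exact cnt_congr fun y _ => by simp

/-- `aᵏ - cᵏ ≤ k (a - c) aᵏ⁻¹` for `c ≤ a`. [folklore] -/
theorem pow_sub_pow_le {a c : ℕ} (h : c ≤ a) : ∀ k : ℕ, a ^ k - c ^ k ≤ k * (a - c) * a ^ (k - 1)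
  | 0 => by simp
  | k + 1 => by
    have ih := pow_sub_pow_le h k
    have hck : c ^ k ≤ a ^ k := Nat.pow_le_pow_left h k
    -- a^{k+1} - c^{k+1} = a (a^k - c^k) + (a - c) c^k
    have key : a ^ (k + 1) - c ^ (k + 1) = a * (a ^ k - c ^ k) + (a - c) * c ^ k := by
      zify [h, hck, Nat.pow_le_pow_left h (k + 1)]
      ring
    rw [key, Nat.add_sub_cancel]
    rcases k with _ | k
    · simp
    · rw [Nat.add_sub_cancel] at ih
      calc a * (a ^ (k + 1) - c ^ (k + 1)) + (a - c) * c ^ (k + 1)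
          ≤ a * ((k + 1) * (a - c) * a ^ k) + (a - c) * a ^ (k + 1) :=
            Nat.add_le_add (Nat.mul_le_mul_left _ ih) (Nat.mul_le_mul_left _ hck)
        _ = (k + 1 + 1) * (a - c) * a ^ (k + 1) := by ring

/-- **The bad strings are few**: `cnt (k b) {¬ Good} ≤ k p 2^{b (k-1)}`. [cite: AroraBarakCC2009, Lemma A.31] -/
theorem cnt_not_good_le [NeZero p] (k : ℕ) : cnt (k * b) {ρ | ¬ Good p b k ρ} ≤ k * p * 2 ^ (b * (k - 1)) := by
  have hp : 0 < p := Nat.pos_of_ne_zero (NeZero.ne p)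
  have hc := cnt_add_cnt_compl (k * b) {ρ | Good p b k ρ}
  rw [cnt_good] at hc
  have hpq : p * (2 ^ b / p) ≤ 2 ^ b := Nat.mul_div_le _ _
  have hlt : 2 ^ b - p * (2 ^ b / p) ≤ p := by
    have := Nat.lt_mul_div_succ (2 ^ b) hp
    rw [Nat.mul_succ] at this
    omega
  have hbad : cnt (k * b) {ρ | Good p b k ρ}ᶜ = 2 ^ (k * b) - (p * (2 ^ b / p)) ^ k := by omega
  have hpow : (2 : ℕ) ^ (k * b) = (2 ^ b) ^ k := by rw [mul_comm, pow_mul]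
  calc cnt (k * b) {ρ | ¬ Good p b k ρ} = cnt (k * b) {ρ | Good p b k ρ}ᶜ := rfl
    _ = (2 ^ b) ^ k - (p * (2 ^ b / p)) ^ k := by rw [hbad, hpow]
    _ ≤ k * (2 ^ b - p * (2 ^ b / p)) * (2 ^ b) ^ (k - 1) := pow_sub_pow_le hpq k
    _ ≤ k * p * (2 ^ b) ^ (k - 1) := Nat.mul_le_mul_right _ (Nat.mul_le_mul_left _ hlt)
    _ = k * p * 2 ^ (b * (k - 1)) := by rw [← pow_mul]

/-! ### The probability bound -/

/-- **Coins to tapes.** For every event `A` of tapes,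
`Pr_{ρ ∈ {0,1}^{kb}}[¬ Good ρ ∨ dec ρ ∈ A] ≤ k p / 2ᵇ + #A / pᵏ`. [cite: AroraBarakCC2009, §7.4.1 and Lemma A.31] -/
theorem uniformProb_bad_or_dec_le [NeZero p] (k : ℕ) (A : Finset (Fin k → ZMod p)) :
    uniformProb (k * b) {ρ | ¬ Good p b k ρ ∨ dec p b k ρ ∈ A} ≤ (k * p : ℝ) / 2 ^ b + (A.card : ℝ) / (p : ℝ) ^ k := by
  classical
  have hp : 0 < p := Nat.pos_of_ne_zero (NeZero.ne p)
  set q := 2 ^ b / p with hq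
  have hpq : p * q ≤ 2 ^ b := Nat.mul_div_le _ _
  -- splitting the event
  have hsplit : cnt (k * b) {ρ | ¬ Good p b k ρ ∨ dec p b k ρ ∈ A} ≤
      cnt (k * b) {ρ | ¬ Good p b k ρ} + cnt (k * b) {ρ | Good p b k ρ ∧ dec p b k ρ ∈ A} := by
    refine (cnt_mono (E' := {ρ | ¬ Good p b k ρ ∨ (Good p b k ρ ∧ dec p b k ρ ∈ A)}) fun y _ hy => ?_).trans
      (cnt_or_le _ _ _)
    simp only [Set.mem_setOf_eq] at hy ⊢
    by_cases hg : Good p b k y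
    · exact Or.inr ⟨hg, hy.resolve_left fun h => h hg⟩
    · exact Or.inl hg
  rw [cnt_good_dec] at hsplit
  have h1 := cnt_not_good_le (p := p) (b := b) k
  -- in `ℝ`
  rw [uniformProb_eq_cnt_div, div_le_iff₀ (by positivity)]
  have hR : (cnt (k * b) {ρ | ¬ Good p b k ρ ∨ dec p b k ρ ∈ A} : ℝ) ≤ (k * p * 2 ^ (b * (k - 1)) : ℕ) + ((q ^ k * A.card : ℕ) : ℝ) := by
    exact_mod_cast hsplit.trans (Nat.add_le_add_right h1 _)
  refine hR.trans ?_
  rw [add_mul]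
  refine add_le_add ?_ ?_
  · -- `k p 2^{b(k-1)} ≤ k p / 2^b · 2^{kb}`
    rcases k with _ | k
    · simp
    · rw [Nat.add_sub_cancel, div_mul_eq_mul_div, le_div_iff₀ (by positivity)]
      have : ((k + 1 : ℕ) * p * 2 ^ (b * k) : ℕ) * (2 : ℝ) ^ b = ((k + 1 : ℕ) : ℝ) * p * 2 ^ ((k + 1) * b) := by
        push_cast
        rw [show (k + 1) * b = b * k + b by ring, pow_add]
        ring
      rw [this]
  · -- `q^k #A ≤ #A / p^k · 2^{kb}` since `(p q)^k ≤ 2^{kb}`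
    rw [div_mul_eq_mul_div, le_div_iff₀ (by positivity)]
    have hle : (q ^ k * A.card * p ^ k : ℕ) ≤ A.card * 2 ^ (k * b) := by
      calc q ^ k * A.card * p ^ k = A.card * (p * q) ^ k := by rw [mul_pow]; ring
        _ ≤ A.card * (2 ^ b) ^ k := Nat.mul_le_mul_left _ (Nat.pow_le_pow_left hpq k)
        _ = A.card * 2 ^ (k * b) := by rw [← pow_mul, mul_comm b k]
    have : ((q ^ k * A.card : ℕ) : ℝ) * (p : ℝ) ^ k = ((q ^ k * A.card * p ^ k : ℕ) : ℝ) := by push_cast; ring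
    rw [this]
    exact_mod_cast hle

/-- **Perfect completeness is kept**: if every tape is in `A`, the event is sure. [folklore] -/
theorem uniformProb_bad_or_dec_eq_one (k : ℕ) {A : Set (Fin k → ZMod p)} (hA : ∀ τ, τ ∈ A) :
    uniformProb (k * b) {ρ | ¬ Good p b k ρ ∨ dec p b k ρ ∈ A} = 1 := by
  rw [uniformProb_eq_cnt_div, cnt_eq_two_pow_of_forall (E := {ρ | ¬ Good p b k ρ ∨ dec p b k ρ ∈ A}) fun y _ => Or.inr (hA _)]
  simp

end PCPCoins

end Literature.Computability.Complexity

end
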